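import Mathlib
import HarnessLib

/-!
# Ventures/CertifiedQuantumChemistry — Rows/SqrtTwoFactorPSD.lean: kernel arithmetic in `ℚ(√2)` as RATIONAL PAIRS and
# the `LDLᵀ`-FACTOR positivity certificate over it (no field instance, no order instance: three functions and their
# soundness under `(p, q) ↦ p + q√2`)

HONEST FRAMING (verbatim): certified bounds for a stated model Hamiltonian in a stated basis; not a
claim about the real molecule beyond that model. Nothing in this file asserts a value, a row or a claim
node; it types a CERTIFICATE FORMAT (data over `ℚ × ℚ`, conclusions over `ℝ`).

Seat rdm-B (gen 41), zero compute. Motivation: the exact lift of the `L = 4` plateau constant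
(`pub-qchem-rdmb/ab-files/v39/lift_L4_DQG.json`, STRUCTURE §2.2.14) lives in the field `ℚ(√2)` — its order-0 point
is the X_∞ optimiser with coherences `±√2/8`, its value is `−8 − 4√2` — so a kernel certificate of its feasibility needs
exact arithmetic with `√2`. The Python checker of record represents a number as a pair `[p, q] = p + q√2`; this file does
the same INSIDE LEAN with the least possible structure: pairs `ℚ × ℚ` with Mathlib's componentwise `+`, `−`, `0`, `Σ`,
ONE extra function `SqrtTwo.mul`, ONE Boolean sign test `SqrtTwo.nonneg`, and the evaluation
`SqrtTwo.toReal (p, q) = p + q·√2`; everything the kernel decides is rational, everything concluded is real: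

* §1 `toReal` is additive (`toRealHom`), multiplicative on `mul` (`toReal_mul`, `√2·√2 = 2`), and `nonneg a = true →
  0 ≤ toReal a` (`toReal_nonneg`: the three sign cases, squares compared rationally); `|toReal (p, q)| ≤ |p| + (3/2)|q|`
  (`abs_toReal_le`, for row-sum bounds that may stay rational).
* §2 **`posSemidef_of_factor`** — the `LDLᵀ`-FACTOR CERTIFICATE: if `M i j = Σ_k mul (mul (F i k) (D k)) (F j k)` as
  PAIRS (decidable on literal tables: `d²·r` pair products, no division, no pivoting in the kernel) and every `D k`
  passes `nonneg`, then the real matrix `(toReal (M i j))_{ij}` is positive semidefinite (`F·diag(D)·Fᵀ`, Mathlib's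
  `PosSemidef.mul_mul_conjTranspose_same`). The factor is found OFFLINE (exact `LDLᵀ` over `ℚ(√2)`); rank deficiency is
  no obstacle (`r < d`, or zero pivots). `posSemidef_of_factor_rat` is the same for plain rational tables (`q = 0`), an
  alternative to running `ExactLDL.ldlAccept` (`Rows/ExactLDLDecision.lean`) inside the kernel when elimination is slow.

0 `sorry`; three `def`s (`toReal`, `mul`, `nonneg`) and one bundled additive hom; no instance, no `def … : Prop`;
standard axioms. References (docstring-only): R. A. Horn, C. R. Johnson, Matrix Analysis (2nd ed.) Obs. 7.1.8, Thm 7.2.7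
(Gram / `LDLᵀ` characterisations of semidefiniteness).
-/

namespace Summit.Ventures.CertifiedQuantumChemistry

namespace SqrtTwo

open Matrix Finset

/-! ## §1 Pairs `(p, q) ↦ p + q√2` -/

/-- The real number denoted by a rational pair: `toReal (p, q) = p + q·√2`. -/
noncomputable def toReal (a : ℚ × ℚ) : ℝ := (a.1 : ℝ) + (a.2 : ℝ) * Real.sqrt 2

/-- The product of two pairs in `ℚ(√2)`: `(p, q)·(p', q') = (pp' + 2qq', pq' + qp')`. -/
def mul (a b : ℚ × ℚ) : ℚ × ℚ := (a.1 * b.1 + 2 * (a.2 * b.2), a.1 * b.2 + a.2 * b.1)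

/-- The Boolean sign test: `p + q√2 ≥ 0` iff (`p, q ≥ 0`) or (`p ≥ 0 ≥ q` and `2q² ≤ p²`) or (`q ≥ 0 ≥ p` and
`p² ≤ 2q²`) — rational comparisons only. -/
def nonneg (a : ℚ × ℚ) : Bool :=
  decide ((0 ≤ a.1 ∧ 0 ≤ a.2) ∨ (0 ≤ a.1 ∧ a.2 ≤ 0 ∧ 2 * a.2 ^ 2 ≤ a.1 ^ 2) ∨
    (a.1 ≤ 0 ∧ 0 ≤ a.2 ∧ a.1 ^ 2 ≤ 2 * a.2 ^ 2))

/-- Evaluation of a literal pair. -/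
@[simp] theorem toReal_mk (p q : ℚ) : toReal (p, q) = (p : ℝ) + (q : ℝ) * Real.sqrt 2 := rfl

/-- `toReal` as an additive monoid homomorphism (componentwise addition of pairs). -/
noncomputable def toRealHom : ℚ × ℚ →+ ℝ where
  toFun := toReal
  map_zero' := by simp [toReal]
  map_add' a b := by simp only [toReal, Prod.fst_add, Prod.snd_add, Rat.cast_add]; ring

/-- The bundled hom is `toReal`. -/
@[simp] theorem toRealHom_apply (a : ℚ × ℚ) : toRealHom a = toReal a := rfl

/-- Additivity. -/
theorem toReal_add (a b : ℚ × ℚ) : toReal (a + b) = toReal a + toReal b := toRealHom.map_add a b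

/-- Zero. -/
theorem toReal_zero : toReal 0 = 0 := toRealHom.map_zero

/-- Negation. -/
theorem toReal_neg (a : ℚ × ℚ) : toReal (-a) = -toReal a := toRealHom.map_neg a

/-- Subtraction. -/
theorem toReal_sub (a b : ℚ × ℚ) : toReal (a - b) = toReal a - toReal b := toRealHom.map_sub a b

/-- Finite sums. -/
theorem toReal_sum {ι : Type*} (s : Finset ι) (f : ι → ℚ × ℚ) :
    toReal (∑ i ∈ s, f i) = ∑ i ∈ s, toReal (f i) := map_sum toRealHom f s

/-- Multiplicativity: `toReal (mul a b) = toReal a · toReal b` (`√2 · √2 = 2`). -/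
theorem toReal_mul (a b : ℚ × ℚ) : toReal (mul a b) = toReal a * toReal b := by
  have h2 : Real.sqrt 2 * Real.sqrt 2 = 2 := Real.mul_self_sqrt (by norm_num)
  simp only [toReal, mul, Rat.cast_add, Rat.cast_mul, Rat.cast_ofNat]
  linear_combination (-((a.2 : ℝ) * b.2)) * h2

/-- Rational numbers as pairs: `toReal (p, 0) = p`. -/
theorem toReal_rat (p : ℚ) : toReal (p, 0) = p := by simp [toReal]

/-- **Soundness of the sign test**: `nonneg a = true → 0 ≤ toReal a`. -/
theorem toReal_nonneg {a : ℚ × ℚ} (h : nonneg a = true) : 0 ≤ toReal a := by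
  obtain ⟨p, q⟩ := a
  have hs0 : 0 ≤ Real.sqrt 2 := Real.sqrt_nonneg 2
  have hs2 : Real.sqrt 2 ^ 2 = 2 := Real.sq_sqrt (by norm_num)
  simp only [nonneg, decide_eq_true_eq] at h
  simp only [toReal_mk]
  rcases h with ⟨hp, hq⟩ | ⟨hp, hq, hpq⟩ | ⟨hp, hq, hpq⟩
  · have : (0 : ℝ) ≤ q := by exact_mod_cast hq
    have : (0 : ℝ) ≤ p := by exact_mod_cast hp
    positivity
  · -- p ≥ 0 ≥ q, 2q² ≤ p²: p ≥ |q|√2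
    have hp' : (0 : ℝ) ≤ p := by exact_mod_cast hp
    have hq' : (q : ℝ) ≤ 0 := by exact_mod_cast hq
    have hpq' : 2 * (q : ℝ) ^ 2 ≤ (p : ℝ) ^ 2 := by exact_mod_cast hpq
    -- (−q√2)² = 2q² ≤ p² and both −q√2, p ≥ 0
    have h1 : (-(q : ℝ) * Real.sqrt 2) ^ 2 ≤ (p : ℝ) ^ 2 := by nlinarith [hs2]
    have h2 : 0 ≤ -(q : ℝ) * Real.sqrt 2 := by nlinarith
    have h3 : -(q : ℝ) * Real.sqrt 2 ≤ p := (abs_le_of_sq_le_sq' h1 hp').2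
    nlinarith
  · have hp' : (p : ℝ) ≤ 0 := by exact_mod_cast hp
    have hq' : (0 : ℝ) ≤ q := by exact_mod_cast hq
    have hpq' : (p : ℝ) ^ 2 ≤ 2 * (q : ℝ) ^ 2 := by exact_mod_cast hpq
    have h1 : (-(p : ℝ)) ^ 2 ≤ ((q : ℝ) * Real.sqrt 2) ^ 2 := by nlinarith [hs2]
    have h2 : 0 ≤ (q : ℝ) * Real.sqrt 2 := by positivity
    have h3 : -(p : ℝ) ≤ (q : ℝ) * Real.sqrt 2 := (abs_le_of_sq_le_sq' h1 h2).2
    nlinarith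

/-- A rational bound for absolute values in `ℚ(√2)`: `|p + q√2| ≤ |p| + (3/2)|q|` (`√2 < 3/2`). -/
theorem abs_toReal_le (a : ℚ × ℚ) : |toReal a| ≤ |(a.1 : ℝ)| + 3 / 2 * |(a.2 : ℝ)| := by
  obtain ⟨p, q⟩ := a
  have hs : Real.sqrt 2 ≤ 3 / 2 := by
    rw [show (3 / 2 : ℝ) = Real.sqrt ((3 / 2) ^ 2) by rw [Real.sqrt_sq (by norm_num)]]
    exact Real.sqrt_le_sqrt (by norm_num)
  have hs0 : 0 ≤ Real.sqrt 2 := Real.sqrt_nonneg 2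
  simp only [toReal_mk]
  calc |(p : ℝ) + (q : ℝ) * Real.sqrt 2| ≤ |(p : ℝ)| + |(q : ℝ) * Real.sqrt 2| := abs_add_le _ _
    _ = |(p : ℝ)| + |(q : ℝ)| * Real.sqrt 2 := by rw [abs_mul, abs_of_nonneg hs0]
    _ ≤ |(p : ℝ)| + |(q : ℝ)| * (3 / 2) := by gcongr
    _ = |(p : ℝ)| + 3 / 2 * |(q : ℝ)| := by ring

/-! ## §2 The `LDLᵀ`-factor certificate -/

/-- **`LDLᵀ`-FACTOR CERTIFICATE OVER `ℚ(√2)`.** If, as pair tables, `M i j = Σ_k F i k · D k · F j k` and every `D k`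
passes the sign test, then the real matrix `(toReal (M i j))` is positive semidefinite (`M = F·diag(D)·Fᵀ`). The
identity and the sign tests are decided by the kernel on literal tables; the factor comes from an offline exact
`LDLᵀ`. -/
theorem posSemidef_of_factor {d r : ℕ} (M : Fin d → Fin d → ℚ × ℚ) (F : Fin d → Fin r → ℚ × ℚ) (D : Fin r → ℚ × ℚ)
    (hfac : ∀ i j, M i j = ∑ k, mul (mul (F i k) (D k)) (F j k)) (hD : ∀ k, nonneg (D k) = true) :
    (Matrix.of fun i j => toReal (M i j)).PosSemidef := by
  set Fr : Matrix (Fin d) (Fin r) ℝ := Matrix.of fun i k => toReal (F i k) with hFr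
  set Dr : Fin r → ℝ := fun k => toReal (D k) with hDr
  have hdiag : (Matrix.diagonal Dr).PosSemidef := Matrix.PosSemidef.diagonal fun k => toReal_nonneg (hD k)
  have h := hdiag.mul_mul_conjTranspose_same Fr
  have e : Fr * Matrix.diagonal Dr * Fr.conjTranspose = Matrix.of fun i j => toReal (M i j) := by
    ext i j
    rw [Matrix.mul_apply]
    simp only [hFr, hDr, Matrix.mul_diagonal, Matrix.conjTranspose_apply, star_trivial, Matrix.of_apply, hfac i j,
      toReal_sum, toReal_mul]
  rwa [e] at h

/-- **`LDLᵀ`-FACTOR CERTIFICATE, RATIONAL DATA.** The same with rational tables (pairs `(x, 0)`): if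
`M i j = Σ_k F i k · D k · F j k` over `ℚ` and `0 ≤ D k`, the real matrix `M.map Rat.cast` is positive semidefinite. -/
theorem posSemidef_of_factor_rat {d r : ℕ} (M : Matrix (Fin d) (Fin d) ℚ) (F : Fin d → Fin r → ℚ) (D : Fin r → ℚ)
    (hfac : ∀ i j, M i j = ∑ k, F i k * D k * F j k) (hD : ∀ k, 0 ≤ D k) :
    (M.map (Rat.cast : ℚ → ℝ)).PosSemidef := by
  set Fr : Matrix (Fin d) (Fin r) ℝ := Matrix.of fun i k => (F i k : ℝ) with hFr
  set Dr : Fin r → ℝ := fun k => (D k : ℝ) with hDr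
  have hdiag : (Matrix.diagonal Dr).PosSemidef :=
    Matrix.PosSemidef.diagonal fun k => by simpa [hDr] using (Rat.cast_nonneg (K := ℝ)).2 (hD k)
  have h := hdiag.mul_mul_conjTranspose_same Fr
  have e : Fr * Matrix.diagonal Dr * Fr.conjTranspose = M.map (Rat.cast : ℚ → ℝ) := by
    ext i j
    rw [Matrix.mul_apply]
    simp only [hFr, hDr, Matrix.mul_diagonal, Matrix.conjTranspose_apply, star_trivial, Matrix.of_apply,
      Matrix.map_apply, hfac i j, Rat.cast_sum, Rat.cast_mul]
  rwa [e] at h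

end SqrtTwo

end Summit.Ventures.CertifiedQuantumChemistry
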